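import Summits.CriticalPhenomena.SAWScalingLimit.Theses.SAWMassiveIsingTilt
import Summits.CriticalPhenomena.SAWScalingLimit.Theorems.SAWMassiveIsingTiltDefs
import Literature.Probability.RandomPlanarGeometry.ConformalRestrictionHolds
import Literature.Probability.RandomPlanarGeometry.ConformalRestrictionLocal
import Literature.Probability.RandomPlanarGeometry.HullRestrictionSLEHolds
import Literature.Probability.RandomPlanarGeometry.CritPercSLESimplePathHolds
import Literature.Probability.RandomPlanarGeometry.SLEExistenceNeEightHolds
import Summits.CriticalPhenomena.SAWScalingLimit.Theorems.SAWMassiveIsingTiltMassiveWindowSLEStubCommonEndpointApprox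
import Summits.CriticalPhenomena.SAWScalingLimit.Theorems.SAWMassiveIsingTiltMassiveWindowSLEStubNoTouchOfNearTouchEstimate
import Summits.CriticalPhenomena.SAWScalingLimit.Theorems.SAWMassiveIsingTiltMassiveWindowSLEStubHullRestrictionOfDefect
import Summits.CriticalPhenomena.SAWScalingLimit.Theorems.SAWMassiveIsingTiltMassiveWindowSLEStubWindowLSWFamily
import Summits.CriticalPhenomena.SAWScalingLimit.Theorems.SAWMassiveIsingTiltMassiveWindowSLEStubWindowNesting
import Summits.CriticalPhenomena.SAWScalingLimit.Theorems.SAWMassiveIsingTiltMassiveWindowSLEStubWindowRestrictionDefectOfMixing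
import Summits.CriticalPhenomena.SAWScalingLimit.Theorems.SAWMassiveIsingTiltMassiveWindowSLEStubWindowDiscrepancyGeometry
import Summits.CriticalPhenomena.SAWScalingLimit.Theorems.SAWMassiveIsingTiltMassiveWindowSLEStubZloopEdgeCalculus
import Summits.CriticalPhenomena.SAWScalingLimit.Theorems.SAWMassiveIsingTiltMassiveWindowSLEStubIsingTwoPointLocality
import Summits.CriticalPhenomena.SAWScalingLimit.Theorems.SAWMassiveIsingTiltMassiveWindowSLEStubWindowLimitChordal
import Summits.CriticalPhenomena.SAWScalingLimit.Theorems.SAWMassiveIsingTiltMassiveWindowSLEStubZloopMixingEdgeBound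
import Summits.CriticalPhenomena.SAWScalingLimit.Theorems.SAWMassiveIsingTiltMassiveWindowSLEStubZloopRatioMixingCore
import Summits.CriticalPhenomena.SAWScalingLimit.Theorems.SAWMassiveIsingTiltMassiveWindowSLEStubZloopRateRatioMixing
import Summits.CriticalPhenomena.SAWScalingLimit.Theorems.SAWMassiveIsingTiltMassiveWindowSLEStubAvoidRestrictionOfDefect
import Summits.CriticalPhenomena.SAWScalingLimit.Theorems.SAWMassiveIsingTiltMassiveWindowSLEStubHullRestrictionOfAvoidRestriction
import Summits.CriticalPhenomena.SAWScalingLimit.Theorems.SAWMassiveIsingTiltMassiveWindowSLELineReduction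

/-!
# Skeleton r11 — crux `SAWMassiveIsingTilt.MassiveWindowSLE` (stmt-CriticalPhenomena-7685), line `registered`

Route `route-CriticalPhenomena-SAWMassiveIsingTilt` (CriticalPhenomena / SAWScalingLimit), crux rank 2
"COOL AND PAY ⇒ 8/3": along some window schedule `y(δ) = 1/√3 − m(δ)δ` (`m → ∞`, `mδ → 0`) and tilt
`x(δ)` the tilted massive-Ising interface laws `𝔓_{x(δ),y(δ)}` of every Dobrushin domain converge to
chordal SLE_{8/3}.

r11 (lead c5): no reshape of the open stub. The composition itself is now a TREE THEOREM:
`Theorems/SAWMassiveIsingTiltMassiveWindowSLELineReduction.lean` (p163174) lands R'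
(`windowRestrictionDefect_of_rateMixing`), `rateWindowLSWFamily_of_covariantSimpleRateWindowLimit`
(S1' ⇒ the window-LSW family along the SAME schedule), the characterisation
`covariantSimpleRateWindowLimit_iff_rateWindowLSWFamily` (S1' ⟺ fast-RATE positive-tilt window-LSW
family: the gap between S1' and the crux is the schedule class alone, cf. p146711) and the registered
sub-goal `massiveWindowSLE_of_covariantSimpleRateWindowLimit : S1' → MassiveWindowSLE`. This file
therefore keeps the stub declarations (the line's documentation; landed ones by name) and concludes the
crux in one line. ONE sorry = S1' (crux-sized; lead c5 adds a Monte-Carlo probe of its one quantitative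
risk, θ-collapse of the critical-tilt interface — see Cruxes/MassiveWindowSLE/PROMOTE-r11.md).

History. r1–r3 (planner): S1 (covariant simple window limit along a FAST schedule) / NoTouch /
restriction from mass, composed through LSW 2003 hull form (PROVED in the tree). r4 (lead c1): stub 3
repaired; `promote-stub` S1. r5–r6b (lead c2): the universal stubs cut into lattice inputs + passage glue;
SIX stubs landed (C p148631, 3b p149783, 2b p150466, T p146711 with the converse iff, N p151799,
R p151993); residue {S1, 3a, M}; `promote-stub` S1 again.

r7 (lead c3, this file) keeps the composition idea and RE-PARAMETRISES THE SCHEDULE. The registered FAST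
condition `m/log δ⁻¹ → ∞` made the engine M (window ratio mixing of `Zloop`) depend on an unprinted
near-critical input (the LINEAR correlation length of the honeycomb Ising model up to `β_c`, needed to
turn `β_c − β ≍ mδ·δ` into a lattice mass `≳ mδ·δ`). Since S1 is EXISTENTIAL in the schedule, r7 lets
the schedule carry its own intrinsic subcritical rate: RATE(m, c) = "the high-temperature two-point
function of the honeycomb loop/Ising model at the window weight `y(δ)` decays, uniformly over finite
volumes, at rate `c(δ)` in the embedded distance, and `c(δ) ≫ δ log δ⁻¹`". Along RATE-schedules the
restriction defect is `≲ δ^{-O(1)} e^{-c(δ) ε/δ} → 0` with NO near-critical input, and M becomes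
provable from the tree's Ising toolbox (GKS II and graph/volume monotonicity `GKSInequalities`,
`GriffithsMonotonicity`; the GHS boundary bounds `TwoPointPlusDecay.isingTwoPoint_plus_sub_free_le_boundary`,
`MeanFieldBoundGHS.isingCorr_plus_singleton_le_boundary_twoPoint`; the high-temperature expansion
`ModifiedSimonInequality.isingCorr_free_eq_hteSum_div`). RATE-schedules with `m → ∞` exist by
sharpness of the honeycomb Ising transition at `tanh β_c = 1/√3` (Cimasoni–Duminil-Copin 2013;
Aizenman–Barsky–Fernández 1987 / Duminil-Copin–Raoufi–Tassion 2019): slowly closing windows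
`y_c − y(δ) → 0` qualify; under `ν = 1` the old fast schedules are RATE-schedules too.

r10 (lead c4): THE NEAR-TOUCH STUB 3a IS ELIMINATED FROM THE LINE. Diagnosis: NoTouch was needed only
because the tree's `ChordalFamily.IsHullRestriction` conditions on the CLOSED event `{γ ⊆ cl D'}`,
whereas the tree's proof of LSW 2003 uniqueness (`RestrictionPullback.pullbackLaw_avoid_hullProduct`
→ `isArcHullMultiplicative_pullbackLaw` → `isRestrictionMeasure_pullbackLaw'` →
`LawlerSchrammWerner2003_unique_of_facts'`) consumes restriction ONLY through AVOIDANCE probabilities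
`{range ∩ cl (D ∖ D') = ∅}` of pulled-back hulls — and the landed engine (N + F1–F3 + R') delivers the
restriction identity in exactly that avoidance form without any boundary estimate. New stubs, both
proved by the lead and LANDED (2b' p161236, T' p161180; sorry-free, standard axioms):
2b' `stub_avoidRestrictionOfDefect` (defect ⇒ avoidance-form restriction: the 2b portmanteau glue with
the `ε`-layer removed by monotone convergence instead of NoTouch) and T'
`stub_hullRestrictionOfAvoidRestriction` (chordal + covariant + avoidance-form + simple ⇒
`IsHullRestriction`, via the avoidance-form twin of `pullbackLaw_avoid_hullProduct` and the LSW pipeline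
against the SLE_{8/3} family, `IsSLELaw.hullRestriction_eightThirds_holds`). 3a, 3b, 2b and C leave the
composition (3b, 2b, C stay landed). Composition r10: S1' → Ch → N, F3, R' → 2b' → T' → T → crux BY
NAME; the line is CLOSED MODULO S1' ALONE (crux minus restriction) — 1 sorry.

r9 (lead c3, after wave 2): Ch `stub_windowLimitChordal` (p156761) and the three engine pieces
`stub_zloopMixingEdgeBound` (p157273), `stub_zloopRatioMixingCore` (p157736), `stub_zloopRateRatioMixing`
(p158223) LANDED. THE ENGINE OF THE LINE (restriction from mass, RATE form) IS PROVED: the line is now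
CLOSED MODULO exactly {S1' `stub_covariantSimpleRateWindowLimit` (crux-sized: existence + conformal
covariance + simplicity of a fast RATE-window limit with positive tilt), 3a `stub_windowNearTouchEstimate`
(lattice near-touch estimate ⟺ NoTouch of the window limit; unprinted)} — 2 sorries.

r8 (lead c3, after wave 1): Mgeo `stub_windowDiscrepancyGeometry` (p155911), Malg
`stub_zloopEdgeCalculus` (p155494) and MIsing `stub_isingTwoPointLocality` (p155968) LANDED; the wave-1
worker REFUTED r7's chordality stub (witness `m := 0, x := 0, P := 0`: at zero tilt the window laws
are the zero measure and converge vacuously), so S1' now carries eventual positivity of the tilt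
`0 < x δ` and Ch the corrected hypotheses; the engine Mmix (proved sorry-free by its worker in the
implication form, 823 lines — too long for one file and for the 3900-character registry cap) is
re-cut into three hypothesis-free registered pieces landing in sequence: `stub_zloopMixingEdgeBound`
(one attachment edge: MIsing + RATE in a honeycomb ball), `stub_zloopRatioMixingCore` (fixed-mesh
core: telescoping + counting) and `stub_zloopRateRatioMixing` (M'': the eventual statement along fast
RATE-schedules); only M'' enters the composition, the other two are its registered antecedents.

Stubs of r8 (6 active; r9: 2 active, S1' and 3a): S1' `stub_covariantSimpleRateWindowLimit` (OPEN, crux-sized), Ch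
`stub_windowLimitChordal` (proved by the worker, landing), 3a `stub_windowNearTouchEstimate` (OPEN),
`stub_zloopMixingEdgeBound`, `stub_zloopRatioMixingCore`, `stub_zloopRateRatioMixing` (proved in
implication form, landing F1 → F2 → F3). Landed and used by name: C, 3b, N, 2b, T, Mgeo, Malg, MIsing.

(r7 description, kept for reference:)
Stubs of r7 (7 active):
* `stub_covariantSimpleRateWindowLimit` (S1', OPEN, crux-sized): ∃ fast RATE-schedule, tilt and window
  limit family `P`, conformally covariant and carried by simple curves (S1 minus chordality, plus RATE);
* `stub_windowLimitChordal` (Ch, provable now): a window-limit family is chordal (portmanteau: lattice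
  endpoints converge to the marked points, lattice polylines lie in `cl D`, masses converge);
* `stub_windowNearTouchEstimate` (3a, verbatim, OPEN lattice boundary estimate ⟺ NoTouch);
* `stub_windowDiscrepancyGeometry` (Mgeo, provable now): hex-ball counting; eventually `Ω'_δ ⊆ Ω_δ`,
  `H' ≤ H`, and every `H`-edge at an `Ω'_δ`-vertex missing from `H'` lies within `δ` of `cl (D ∖ D')`;
* `stub_zloopEdgeCalculus` (Malg, provable now): `Zloop(H + e) = Zloop(H) + y·W_H(u,v)` and
  `Zloop(H₁ ⊔ H₂) = Zloop(H₁)·Zloop(H₂)` for vertex-disjoint supports;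
* `stub_isingTwoPointLocality` (MIsing, provable now): for `H₁, H₂ ≤ hexGraph` agreeing inside a finite
  set `B ∋ u, v`, `|⟨σ_uσ_v⟩_{H₁} − ⟨σ_uσ_v⟩_{H₂}| ≤ 9β²·#B·Σ_{x ∈ ∂B} (⟨σ_uσ_x⟩ + ⟨σ_vσ_x⟩)^{free}_{B;hex}`
  in loop language (`W/Zloop`), by the GKS sandwich `free(B) ≤ · ≤ plus(B)` and the GHS boundary bounds;
* `stub_zloopRatioMixing_of_locality` (Mmix, provable now): Mgeo + Malg + MIsing ⇒ RATE-form window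
  ratio mixing (telescoping over the `≤ δ^{-O(1)}` attachment edges near the removed hull, each factor
  within `poly(ε/δ)·e^{-c(δ)(ε/δ)}` by MIsing + RATE, summable to `o(1)` because `c(δ) ≫ δ log δ⁻¹`).
Proved in this file (no stub): `windowRestrictionDefect_of_rateMixing` (R', c2's R with RATE threaded).
Landed and used by name: C, 3b, N, 2b, T (namespace `…Theorems.MassiveWindowSLE.Birth`).

Composition `MassiveWindowSLE_of` (sorry-free), r10: S1' gives `m, x, c, P`; Ch gives chordality;
N + (Mgeo, Malg, MIsing ⇒ F1–F3) + R' give the restriction defect at `(m, x)`; 2b' gives avoidance-form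
restriction; T' gives hull restriction; `m → ∞` from fastness; T (LSW 2003) closes.
-/

namespace Summit.CriticalPhenomena.SAWScalingLimit.Cruxes.MassiveWindowSLE.Birth

open scoped BigOperators Topology Classical MeasureTheory NNReal ENNReal
open Filter Set MeasureTheory
open Literature.Probability Literature.Probability.RandomPlanarGeometry


/-- **Stub S1' (N1 + N3 along a RATE-schedule; OPEN, crux-sized): a conformally covariant, simple
window limit exists along some fast schedule carrying its own subcritical rate.** There are a tilt `x(δ)`,
a window schedule `m(δ)` (`m δ·δ → 0`, `m δ / log δ⁻¹ → +∞`), a rate function `c(δ)` with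
`c(δ) / (δ log δ⁻¹) → +∞` such that, eventually, the loop-`O(1)` two-point function of the honeycomb
lattice at the window weight `y(δ) = 1/√3 − m(δ)δ` obeys `W_Λ(u,v) ≤ e^{-c(δ)·|c(u) − c(v)|} Zloop_Λ`
uniformly over finite volumes `Λ ∋ u, v` (RATE), and ONE family `P` such that for every Dobrushin
domain and hexagonal endpoint approximation the window laws converge weakly to `P D`; and `P` is
conformally covariant and carried by simple curves. Chordality of `P` is automatic
(`stub_windowLimitChordal`). RATE-schedules exist by sharpness of the honeycomb Ising transition at
`tanh β_c = 1/√3`; what is OPEN is existence + covariance + simplicity of the window limit (the crux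
minus hull restriction, by `massiveWindowSLE_iff_windowLSWFamily`). r8: the tilt is eventually POSITIVE (`0 < x δ`), which makes the window laws honest probability measures (without it `x := 0, P := 0` satisfies the window-limit clause vacuously — worker finding on r7's Ch). -/
theorem stub_covariantSimpleRateWindowLimit :
    ∃ (m x c : ℝ → ℝ) (P : Literature.Probability.RandomPlanarGeometry.ChordalFamily), (Filter.Tendsto (fun δ => m δ * δ) (nhdsWithin 0 (Set.Ioi 0)) (nhds 0) ∧ Filter.Tendsto (fun δ => m δ / Real.log δ⁻¹) (nhdsWithin 0 (Set.Ioi 0)) Filter.atTop ∧ ∀ (D : Literature.Probability.RandomPlanarGeometry.DobrushinDomain) (a b : ℝ → Literature.Probability.LatticeModels.HexVertex), Literature.Probability.RandomPlanarGeometry.SAW.IsEmbEndpointApprox Literature.Probability.LatticeModels.hexGraph Literature.Probability.LatticeModels.hexCenter D a b → Literature.Probability.RandomPlanarGeometry.TendstoLaw (fun δ (γ : Literature.Probability.RandomPlanarGeometry.SAW.HexDomainSAW D.carrier δ (a δ) (b δ)) => γ.curve) (fun δ => Summit.CriticalPhenomena.SAWScalingLimit.Theorems.SAWMassiveIsingTilt.tiltLaw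 D.carrier δ (x δ) ((Real.sqrt 3)⁻¹ - m δ * δ) (a δ) (b δ)) id (P D)) ∧ (Filter.Tendsto (fun δ => c δ / (δ * Real.log δ⁻¹)) (nhdsWithin 0 (Set.Ioi 0)) Filter.atTop ∧ ∀ᶠ δ in nhdsWithin 0 (Set.Ioi 0), ∀ (Λ : Finset Literature.Probability.LatticeModels.HexVertex) (u v : Literature.Probability.LatticeModels.HexVertex), u ∈ Λ → v ∈ Λ → u ≠ v → (∑ᶠ E ∈ {E : Finset (Sym2 Literature.Probability.LatticeModels.HexVertex) | (∀ e ∈ E, e ∈ (Literature.Probability.LatticeModels.hexGraph).edgeSet ∧ ∀ w ∈ e, w ∈ (↑Λ : Set Literature.Probability.LatticeModels.HexVertex)) ∧ ∀ w : Literature.Probability.LatticeModels.HexVertex, (Odd (E.filter (fun e => w ∈ e)).card ↔ (w = u ∨ w = v))}, ((Real.sqrt 3)⁻¹ - m δ * δ) ^ E.card) ≤ Real.exp (-(c δ * dist (Literature.Probability.LatticeModels.hexCenter u) (Literature.Probability.LatticeModels.hexCenter v))) * Summit.CriticalPhenomena.SAWScalingLimit.Theorems.SAWMassiveIsingTilt.Zloop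 Literature.Probability.LatticeModels.hexGraph (↑Λ : Set Literature.Probability.LatticeModels.HexVertex) ((Real.sqrt 3)⁻¹ - m δ * δ)) ∧ (∀ᶠ δ in nhdsWithin 0 (Set.Ioi 0), 0 < x δ) ∧ P.IsConformallyCovariant ∧ P.IsCarriedBySimpleCurves := by
  sorry


/-- **Stub Ch (glue, provable now): window limits are chordal.** If for every Dobrushin domain and
every hexagonal endpoint approximation the window laws pushed to curve classes converge weakly to
`P D`, then `P` is chordal: every domain HAS an approximation (`Theorems.exists_isEmbEndpointApprox`),
the window laws are eventually probability measures (masses converge, so `P D` is a probability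
measure), the lattice polylines start at `δ·c(a δ) → a`, end at `δ·c(b δ) → b` and lie in `cl D`, and
the complementary events are open, so portmanteau (`ntb_measure_le_of_tendstoLaw`) kills them. r8 (corrected by the wave-1 worker, who REFUTED the r7 form with the witness `m := 0, x := 0, P := 0`): hypotheses `m δ·δ → 0` and eventual positivity of the tilt make the window laws eventually probability measures (`isProbabilityMeasure_tiltLaw_of_reachable`). -/
theorem stub_windowLimitChordal :
    ∀ (m x : ℝ → ℝ) (P : Literature.Probability.RandomPlanarGeometry.ChordalFamily), Filter.Tendsto (fun δ => m δ * δ) (nhdsWithin 0 (Set.Ioi 0)) (nhds 0) → (∀ᶠ δ in nhdsWithin 0 (Set.Ioi 0), 0 < x δ) → (∀ (D : Literature.Probability.RandomPlanarGeometry.DobrushinDomain) (a b : ℝ → Literature.Probability.LatticeModels.HexVertex), Literature.Probability.RandomPlanarGeometry.SAW.IsEmbEndpointApprox Literature.Probability.LatticeModels.hexGraph Literature.Probability.LatticeModels.hexCenter D a b → Literature.Probability.RandomPlanarGeometry.TendstoLaw (fun δ (γ : Literature.Probability.RandomPlanarGeometry.SAW.HexDomainSAW D.carrier δ (a δ) (b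 δ)) => γ.curve) (fun δ => Summit.CriticalPhenomena.SAWScalingLimit.Theorems.SAWMassiveIsingTilt.tiltLaw D.carrier δ (x δ) ((Real.sqrt 3)⁻¹ - m δ * δ) (a δ) (b δ)) id (P D)) → P.IsChordal :=
  -- LANDED (p156761): Theorems/SAWMassiveIsingTiltMassiveWindowSLE…, same name + signature
  Summit.CriticalPhenomena.SAWScalingLimit.Theorems.MassiveWindowSLE.Birth.stub_windowLimitChordal


/-- **Stub C (lattice geometry, provable now): common endpoint approximations.** For every
Dobrushin domain `D` and hull subdomain `D'` there are honeycomb endpoints `a δ, b δ` which are an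
endpoint approximation of BOTH `(D; a, b)` and `(D'; a, b)` (joined in `Ω'_δ` and in `Ω_δ` for small
`δ`, mesh points converging to the common marked points). Route: take any approximation of `D'`
(`Theorems.exists_isEmbEndpointApprox`); an `Ω'_δ`-path re-routed through a fixed compact disc
`K ⊆ D'` is an `Ω_δ`-path because the largest honeycomb mesh component of a Jordan domain is the
bulk (`Theorems.exists_forall_mem_hexMeshDomain_and_reachable`,
`Theorems.reachable_embDomainGraph_of_walk`). Feeds both passage stubs. -/
theorem stub_commonEndpointApprox :
    ∀ D D' : Literature.Probability.RandomPlanarGeometry.DobrushinDomain, D.IsHullSubdomain D' → ∃ a b : ℝ → Literature.Probability.LatticeModels.HexVertex, Literature.Probability.RandomPlanarGeometry.SAW.IsEmbEndpointApprox Literature.Probability.LatticeModels.hexGraph Literature.Probability.LatticeModels.hexCenter D a b ∧ Literature.Probability.RandomPlanarGeometry.SAW.IsEmbEndpointApprox Literature.Probability.LatticeModels.hexGraph Literature.Probability.LatticeModels.hexCenter D' a b :=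
  -- LANDED (p148631): Theorems/SAWMassiveIsingTiltMassiveWindowSLE…, same name + signature
  Summit.CriticalPhenomena.SAWScalingLimit.Theorems.MassiveWindowSLE.Birth.stub_commonEndpointApprox

/-- **Stub N (lattice geometry, provable now — r6 split of 2a): NESTING along common endpoints.**
For a hull pair `D' ⊆ D` with a common endpoint approximation and `ε > 0`, for all small `δ`:
(i) every `Ω'_δ`-SAW from `a δ` to `b δ` is, with the same support, an `Ω_δ`-SAW (segments in
`cl D' ⊆ cl D`; membership in the largest mesh component propagates from `a δ ∈ Ω_δ` along mesh
edges); (ii) every `Ω_δ`-SAW whose curve class lies in `O_ε` (polyline `ε`-away from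
`cl (D ∖ D')`) is, with the same support, an `Ω'_δ`-SAW (mesh points in `D ∖ cl (D∖D') ⊆ D'`, edge
segments ⊆ range of the polyline ⊆ `cl D ∖ cl (D∖D') ⊆ cl D'`, and `a δ ∈ Ω'_δ`). Proved in the
wave-1 audit file (`wrd_eventually_nesting`, `wrd_transfer_of_subset`, `wrd_transfer_of_far`);
to be landed as this stub. -/
theorem stub_windowNesting :
    ∀ (D D' : Literature.Probability.RandomPlanarGeometry.DobrushinDomain), D.IsHullSubdomain D' → ∀ (a b : ℝ → Literature.Probability.LatticeModels.HexVertex), Literature.Probability.RandomPlanarGeometry.SAW.IsEmbEndpointApprox Literature.Probability.LatticeModels.hexGraph Literature.Probability.LatticeModels.hexCenter D a b → Literature.Probability.RandomPlanarGeometry.SAW.IsEmbEndpointApprox Literature.Probability.LatticeModels.hexGraph Literature.Probability.LatticeModels.hexCenter D' a b → ∀ ε : ℝ, 0 < ε → ∀ᶠ δ in nhdsWithin 0 (Set.Ioi 0), (∀ γ' : Literature.Probability.RandomPlanarGeometry.SAW.HexDomainSAW D'.carrier δ (a δ) (b δ), ∃ γ : Literature.Probability.RandomPlanarGeometry.SAW.HexDomainSAW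 D.carrier δ (a δ) (b δ), γ.walk.support = γ'.walk.support) ∧ (∀ γ : Literature.Probability.RandomPlanarGeometry.SAW.HexDomainSAW D.carrier δ (a δ) (b δ), γ.curve ∈ {γ : Literature.Probability.RandomPlanarGeometry.CurveClass ℂ | ∀ z ∈ γ.range, ∀ k ∈ closure (D.carrier \ D'.carrier), ε < dist z k} → ∃ γ' : Literature.Probability.RandomPlanarGeometry.SAW.HexDomainSAW D'.carrier δ (a δ) (b δ), γ'.walk.support = γ.walk.support) :=
  -- LANDED (p151799): Theorems/SAWMassiveIsingTiltMassiveWindowSLE…, same name + signature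
  Summit.CriticalPhenomena.SAWScalingLimit.Theorems.MassiveWindowSLE.Birth.stub_windowNesting

/-- **Stub Mgeo (lattice geometry, provable now): discrepancy edges lie near the removed hull.**
(0) Counting: a Euclidean ball of radius `ρ` contains `≤ C₀ (ρ+1)²` honeycomb vertices (centres).
(1) For a hull pair `D' ⊆ D` and small `δ`: `Ω'_δ ⊆ Ω_δ` (the bulk component of `D'` is joined to a
fixed disc inside `D'`, hence to the bulk of `D`), `H' ≤ H` (mesh edges of `D'` are mesh edges of `D`),
and every `H`-edge `{u, w}` with `u ∈ Ω'_δ` that is not an `H'`-edge has its rescaled segment meeting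
`cl (D ∖ D')` (if `w ∈ Ω'_δ` or `δ c(w) ∈ D'` the segment is not inside `cl D'`, and a point of
`cl D ∖ cl D'` lies in `cl (D ∖ D')`; otherwise `δ c(w) ∈ D ∖ D'`), so `u` is within one rescaled edge
length `δ/√3 ≤ δ` of `cl (D ∖ D')`. Tools: `Theorems.exists_forall_mem_hexMeshDomain_and_reachable`,
`wn_mem_embMeshDomain_of_reachable_ne`, `cea_*` lemmas of the landed C/N files. -/
theorem stub_windowDiscrepancyGeometry :
    (∃ C₀ : ℝ, ∀ (z : ℂ) (ρ : ℝ), 0 ≤ ρ → {w : Literature.Probability.LatticeModels.HexVertex | dist (Literature.Probability.LatticeModels.hexCenter w) z ≤ ρ}.Finite ∧ (({w : Literature.Probability.LatticeModels.HexVertex | dist (Literature.Probability.LatticeModels.hexCenter w) z ≤ ρ}.ncard : ℝ) ≤ C₀ * (ρ + 1) ^ 2)) ∧ ∀ (D D' : Literature.Probability.RandomPlanarGeometry.DobrushinDomain), D.IsHullSubdomain D' → ∀ᶠ δ in nhdsWithin 0 (Set.Ioi 0), Literature.Probability.RandomPlanarGeometry.SAW.embMeshDomain Literature.Probability.LatticeModels.hexGraph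 Literature.Probability.LatticeModels.hexCenter D'.carrier δ ⊆ Literature.Probability.RandomPlanarGeometry.SAW.embMeshDomain Literature.Probability.LatticeModels.hexGraph Literature.Probability.LatticeModels.hexCenter D.carrier δ ∧ Literature.Probability.RandomPlanarGeometry.SAW.hexDomainGraph D'.carrier δ ≤ Literature.Probability.RandomPlanarGeometry.SAW.hexDomainGraph D.carrier δ ∧ ∀ u w : Literature.Probability.LatticeModels.HexVertex, (Literature.Probability.RandomPlanarGeometry.SAW.hexDomainGraph D.carrier δ).Adj u w → ¬ (Literature.Probability.RandomPlanarGeometry.SAW.hexDomainGraph D'.carrier δ).Adj u w → u ∈ Literature.Probability.RandomPlanarGeometry.SAW.embMeshDomain Literature.Probability.LatticeModels.hexGraph Literature.Probability.LatticeModels.hexCenter D'.carrier δ → ∃ k ∈ closure (D.carrier \ D'.carrier), dist ((δ : ℂ) * Literature.Probability.LatticeModels.hexCenter u) k ≤ δ :=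
  -- LANDED (p155911): Theorems/SAWMassiveIsingTiltMassiveWindowSLE…, same name + signature
  Summit.CriticalPhenomena.SAWScalingLimit.Theorems.MassiveWindowSLE.Birth.stub_windowDiscrepancyGeometry


/-- **Stub Malg (loop-gas edge calculus, provable now, pure finite combinatorics).** (a) Adding one
edge `e = {u,v} ∉ H` with `u, v ∈ S`: the even subgraphs of `(H + e)[S]` containing `e` are exactly
`E' + e` for the subgraphs `E'` of `H[S]` with odd vertices `{u, v}`, so
`Zloop(H + e, S) = Zloop(H, S) + y · W_{H,S}(u, v)`. (b) Vertex-disjoint supports: if every edge of `H₁`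
lies inside `A` and every edge of `H₂` outside `A`, the even subgraphs of `(H₁ ⊔ H₂)[S]` are the
disjoint unions of even subgraphs of `H₁[S]` and of `H₂[S]`, so `Zloop` factorises. Tools:
`Theorems.SAWMassiveIsingTilt.zloop_eq_finset_sum`-style conversion of the `finsum` to a `Finset.sum`
over the (finite) powerset, `Finset.sum_bij`, `Finset.sum_product`. -/
theorem stub_zloopEdgeCalculus :
    (∀ (H : SimpleGraph Literature.Probability.LatticeModels.HexVertex) (S : Set Literature.Probability.LatticeModels.HexVertex) (y : ℝ) (u v : Literature.Probability.LatticeModels.HexVertex), H.edgeSet.Finite → u ≠ v → ¬ H.Adj u v → u ∈ S → v ∈ S → Summit.CriticalPhenomena.SAWScalingLimit.Theorems.SAWMassiveIsingTilt.Zloop (H ⊔ SimpleGraph.fromEdgeSet {s(u, v)}) S y = Summit.CriticalPhenomena.SAWScalingLimit.Theorems.SAWMassiveIsingTilt.Zloop H S y + y * (∑ᶠ E ∈ {E : Finset (Sym2 Literature.Probability.LatticeModels.HexVertex) | (∀ e ∈ E, e ∈ (H).edgeSet ∧ ∀ w ∈ e, w ∈ S) ∧ ∀ w : Literature.Probability.LatticeModels.HexVertex,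 (Odd (E.filter (fun e => w ∈ e)).card ↔ (w = u ∨ w = v))}, y ^ E.card)) ∧ (∀ (H₁ H₂ : SimpleGraph Literature.Probability.LatticeModels.HexVertex) (S A : Set Literature.Probability.LatticeModels.HexVertex) (y : ℝ), H₁.edgeSet.Finite → H₂.edgeSet.Finite → (∀ e ∈ H₁.edgeSet, ∀ w ∈ e, w ∈ A) → (∀ e ∈ H₂.edgeSet, ∀ w ∈ e, w ∉ A) → Summit.CriticalPhenomena.SAWScalingLimit.Theorems.SAWMassiveIsingTilt.Zloop (H₁ ⊔ H₂) S y = Summit.CriticalPhenomena.SAWScalingLimit.Theorems.SAWMassiveIsingTilt.Zloop H₁ S y * Summit.CriticalPhenomena.SAWScalingLimit.Theorems.SAWMassiveIsingTilt.Zloop H₂ S y) :=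
  -- LANDED (p155494): Theorems/SAWMassiveIsingTiltMassiveWindowSLE…, same name + signature
  Summit.CriticalPhenomena.SAWScalingLimit.Theorems.MassiveWindowSLE.Birth.stub_zloopEdgeCalculus


/-- **Stub MIsing (locality of the high-temperature two-point function, provable now from the tree's
Ising toolbox).** For `β ≥ 0`, two finite subgraphs `H₁, H₂ ≤ hexGraph` read inside vertex sets
`S₁, S₂`, a finite set `B ⊆ S₁ ∩ S₂` containing `u ≠ v` on which the two graphs agree, and a set `Bd`
containing every vertex of `B` with a honeycomb neighbour outside `B` but not `u, v`: the loop two-point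
functions `W/Zloop` (= `⟨σ_uσ_v⟩^free` of the Ising model on `H_j[S_j]` at `tanh β`, high-temperature
expansion `isingCorr_free_eq_hteSum_div`) differ by at most
`9β²·#B·Σ_{x ∈ Bd} (⟨σ_uσ_x⟩ + ⟨σ_vσ_x⟩)^free_{B; hexGraph}`. Proof: GKS sandwich
`⟨σ_e⟩^free_{B;L} ≤ ⟨σ_e⟩_{H_j[S_j]} ≤ ⟨σ_e⟩^+_{B;H_j[S_j]}` (`isingCorr_free_mono_graph`,
`isingCorr_le_isingCorr_plus`, `isingCorr_plus_le_of_subset`, `isingCorr_free_eq_of_edgesIn_subset`) with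
the common restriction `L` to `B`; then `isingTwoPoint_plus_sub_free_le_boundary` (≤ `3#B` boundary bonds)
and `isingCorr_plus_singleton_le_boundary_twoPoint` + graph monotonicity `H_j[S_j] ≤ hexGraph` in volume `B`. -/
theorem stub_isingTwoPointLocality :
    ∀ (β : ℝ), 0 ≤ β → ∀ (H₁ H₂ : SimpleGraph Literature.Probability.LatticeModels.HexVertex), H₁ ≤ Literature.Probability.LatticeModels.hexGraph → H₂ ≤ Literature.Probability.LatticeModels.hexGraph → H₁.edgeSet.Finite → H₂.edgeSet.Finite → ∀ (S₁ S₂ : Set Literature.Probability.LatticeModels.HexVertex) (B Bd : Finset Literature.Probability.LatticeModels.HexVertex) (u v : Literature.Probability.LatticeModels.HexVertex), u ≠ v → u ∈ B → v ∈ B → u ∉ Bd → v ∉ Bd → (↑B : Set Literature.Probability.LatticeModels.HexVertex) ⊆ S₁ → (↑B : Set Literature.Probability.LatticeModels.HexVertex) ⊆ S₂ → (∀ x ∈ B, ∀ w : Literature.Probability.LatticeModels.HexVertex, Literature.Probability.LatticeModels.hexGraph.Adj x w → w ∉ B → x ∈ Bd) → (∀ x ∈ B, ∀ w ∈ B, (H₁.Adj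 x w ↔ H₂.Adj x w)) → |(∑ᶠ E ∈ {E : Finset (Sym2 Literature.Probability.LatticeModels.HexVertex) | (∀ e ∈ E, e ∈ (H₁).edgeSet ∧ ∀ w ∈ e, w ∈ S₁) ∧ ∀ w : Literature.Probability.LatticeModels.HexVertex, (Odd (E.filter (fun e => w ∈ e)).card ↔ (w = u ∨ w = v))}, (Real.tanh β) ^ E.card) / Summit.CriticalPhenomena.SAWScalingLimit.Theorems.SAWMassiveIsingTilt.Zloop H₁ S₁ (Real.tanh β) - (∑ᶠ E ∈ {E : Finset (Sym2 Literature.Probability.LatticeModels.HexVertex) | (∀ e ∈ E, e ∈ (H₂).edgeSet ∧ ∀ w ∈ e, w ∈ S₂) ∧ ∀ w : Literature.Probability.LatticeModels.HexVertex, (Odd (E.filter (fun e => w ∈ e)).card ↔ (w = u ∨ w = v))}, (Real.tanh β) ^ E.card) / Summit.CriticalPhenomena.SAWScalingLimit.Theorems.SAWMassiveIsingTilt.Zloop H₂ S₂ (Real.tanh β)| ≤ 9 * β ^ 2 * (B.card : ℝ) * ∑ x ∈ Bd, ((∑ᶠ E ∈ {E : Finset (Sym2 Literature.Probability.LatticeModels.HexVertex)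 | (∀ e ∈ E, e ∈ (Literature.Probability.LatticeModels.hexGraph).edgeSet ∧ ∀ w ∈ e, w ∈ (↑B : Set Literature.Probability.LatticeModels.HexVertex)) ∧ ∀ w : Literature.Probability.LatticeModels.HexVertex, (Odd (E.filter (fun e => w ∈ e)).card ↔ (w = u ∨ w = x))}, (Real.tanh β) ^ E.card) + (∑ᶠ E ∈ {E : Finset (Sym2 Literature.Probability.LatticeModels.HexVertex) | (∀ e ∈ E, e ∈ (Literature.Probability.LatticeModels.hexGraph).edgeSet ∧ ∀ w ∈ e, w ∈ (↑B : Set Literature.Probability.LatticeModels.HexVertex)) ∧ ∀ w : Literature.Probability.LatticeModels.HexVertex, (Odd (E.filter (fun e => w ∈ e)).card ↔ (w = v ∨ w = x))}, (Real.tanh β) ^ E.card)) / Summit.CriticalPhenomena.SAWScalingLimit.Theorems.SAWMassiveIsingTilt.Zloop Literature.Probability.LatticeModels.hexGraph (↑B : Set Literature.Probability.LatticeModels.HexVertex) (Real.tanh β) :=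
  -- LANDED (p155968): Theorems/SAWMassiveIsingTiltMassiveWindowSLE…, same name + signature
  Summit.CriticalPhenomena.SAWScalingLimit.Theorems.MassiveWindowSLE.Birth.stub_isingTwoPointLocality


/-- **Stub F1 `stub_zloopMixingEdgeBound` (one attachment edge, provable now — proved by the Mmix
worker as `mix_edge_bound`): for a subgraph `G ≤ hexGraph` with finitely many edges read inside two
vertex sets `S₁, S₂` that both contain the honeycomb ball of radius `ρ ≥ 4` (in centre distance)
around a honeycomb edge `{u, v}`, the loop two-point ratios `W/Zloop` at `y = tanh β` differ by at most
`18 (C₀(ρ+1)²)² e^{-c ρ/2}`, given the counting constant `C₀` and the RATE bound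
`W_Λ(u,v) ≤ e^{-c·dist} Zloop_Λ` at weight `y`. Proof: MIsing (`stub_isingTwoPointLocality`, landed)
with `B` = the ball, `Bd` = its outer unit shell, then RATE on each boundary term. -/
theorem stub_zloopMixingEdgeBound :
    ∀ (C₀ : ℝ), (∀ (z : ℂ) (ρ : ℝ), 0 ≤ ρ → {w : Literature.Probability.LatticeModels.HexVertex | dist (Literature.Probability.LatticeModels.hexCenter w) z ≤ ρ}.Finite ∧ (({w : Literature.Probability.LatticeModels.HexVertex | dist (Literature.Probability.LatticeModels.hexCenter w) z ≤ ρ}.ncard : ℝ) ≤ C₀ * (ρ + 1) ^ 2)) → ∀ (y cδ : ℝ), 0 ≤ y → (∀ (Λ : Finset Literature.Probability.LatticeModels.HexVertex) (u v : Literature.Probability.LatticeModels.HexVertex), u ∈ Λ → v ∈ Λ → u ≠ v → (∑ᶠ E ∈ {E : Finset (Sym2 Literature.Probability.LatticeModels.HexVertex) | (∀ e ∈ E, e ∈ (Literature.Probability.LatticeModels.hexGraph).edgeSet ∧ ∀ w ∈ e, w ∈ (↑Λ : Set Literature.Probability.LatticeModels.HexVertex)) ∧ ∀ w : Literature.Probability.LatticeModels.HexVertex,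 (Odd (E.filter (fun e => w ∈ e)).card ↔ (w = u ∨ w = v))}, y ^ E.card) ≤ Real.exp (-(cδ * dist (Literature.Probability.LatticeModels.hexCenter u) (Literature.Probability.LatticeModels.hexCenter v))) * Summit.CriticalPhenomena.SAWScalingLimit.Theorems.SAWMassiveIsingTilt.Zloop Literature.Probability.LatticeModels.hexGraph (↑Λ : Set Literature.Probability.LatticeModels.HexVertex) y) → 0 ≤ cδ → ∀ (β : ℝ), 0 ≤ β → β ≤ 1 → Real.tanh β = y → ∀ (G : SimpleGraph Literature.Probability.LatticeModels.HexVertex), G ≤ Literature.Probability.LatticeModels.hexGraph → G.edgeSet.Finite → ∀ (S₁ S₂ : Set Literature.Probability.LatticeModels.HexVertex) (ρ : ℝ), 4 ≤ ρ → ∀ (u v : Literature.Probability.LatticeModels.HexVertex), Literature.Probability.LatticeModels.hexGraph.Adj u v → (∀ x : Literature.Probability.LatticeModels.HexVertex, dist (Literature.Probability.LatticeModels.hexCenter x) (Literature.Probability.LatticeModels.hexCenter u) ≤ ρ → x ∈ S₁ ∧ x ∈ S₂) → |(∑ᶠ E ∈ {E : Finset (Sym2 Literature.Probability.LatticeModels.HexVertex)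 | (∀ e ∈ E, e ∈ (G).edgeSet ∧ ∀ w ∈ e, w ∈ S₁) ∧ ∀ w : Literature.Probability.LatticeModels.HexVertex, (Odd (E.filter (fun e => w ∈ e)).card ↔ (w = u ∨ w = v))}, y ^ E.card) / Summit.CriticalPhenomena.SAWScalingLimit.Theorems.SAWMassiveIsingTilt.Zloop G S₁ y - (∑ᶠ E ∈ {E : Finset (Sym2 Literature.Probability.LatticeModels.HexVertex) | (∀ e ∈ E, e ∈ (G).edgeSet ∧ ∀ w ∈ e, w ∈ S₂) ∧ ∀ w : Literature.Probability.LatticeModels.HexVertex, (Odd (E.filter (fun e => w ∈ e)).card ↔ (w = u ∨ w = v))}, y ^ E.card) / Summit.CriticalPhenomena.SAWScalingLimit.Theorems.SAWMassiveIsingTilt.Zloop G S₂ y| ≤ 18 * (C₀ * (ρ + 1) ^ 2) ^ 2 * Real.exp (-(cδ * (ρ / 2))) :=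
  -- LANDED (p157273): Theorems/SAWMassiveIsingTiltMassiveWindowSLE…, same name + signature
  Summit.CriticalPhenomena.SAWScalingLimit.Theorems.MassiveWindowSLE.Birth.stub_zloopMixingEdgeBound


/-- **Stub F2 `stub_zloopRatioMixingCore` (fixed-mesh core of the engine, provable now — proved by the
Mmix worker as `mix_core`): for `H' ≤ H ≤ hexGraph` (finite), a vertex set `V'` carrying `H'`, a
set `K ⊆ ℂ`, mesh `δ`, `16δ ≤ ε`, weight `0 ≤ y ≤ 3/5`, rate `c ≥ 0`, if every `H`-edge at a
`V'`-vertex missing from `H'` is within `δ` of `K` (discrepancy), RATE holds at `y`, and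
`#E(H) · 18 (C₀(ε/(4δ)+1)²)² e^{-cε/(8δ)} ≤ log(1+θ)`, then for any two vertex sets `S₁, S₂` whose
complements lie in `V'` and are `ε`-far from `K`:
`Zloop H S₁ · Zloop H' S₂ ≤ (1+θ) Zloop H' S₁ · Zloop H S₂`. Proof: split `E(H) = E(H') ⊔ FREE ⊔ ATT`,
factor FREE off (Malg(b)), telescope ATT (Malg(a)), bound each factor by F1, sum. -/
theorem stub_zloopRatioMixingCore :
    ∀ (C₀ : ℝ), (∀ (z : ℂ) (ρ : ℝ), 0 ≤ ρ → {w : Literature.Probability.LatticeModels.HexVertex | dist (Literature.Probability.LatticeModels.hexCenter w) z ≤ ρ}.Finite ∧ (({w : Literature.Probability.LatticeModels.HexVertex | dist (Literature.Probability.LatticeModels.hexCenter w) z ≤ ρ}.ncard : ℝ) ≤ C₀ * (ρ + 1) ^ 2)) → ∀ (H H' : SimpleGraph Literature.Probability.LatticeModels.HexVertex), H ≤ Literature.Probability.LatticeModels.hexGraph → H.edgeSet.Finite → H' ≤ H → ∀ (V' : Set Literature.Probability.LatticeModels.HexVertex), (∀ u w : Literature.Probability.LatticeModels.HexVertex, H'.Adj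 u w → u ∈ V') → ∀ (K : Set ℂ) (δ ε θ y cδ NE : ℝ), 0 < δ → 16 * δ ≤ ε → 0 < θ → 0 ≤ y → y ≤ 3 / 5 → 0 ≤ cδ → (∀ u w : Literature.Probability.LatticeModels.HexVertex, H.Adj u w → ¬ H'.Adj u w → u ∈ V' → ∃ k ∈ K, dist ((δ : ℂ) * Literature.Probability.LatticeModels.hexCenter u) k ≤ δ) → (∀ (Λ : Finset Literature.Probability.LatticeModels.HexVertex) (u v : Literature.Probability.LatticeModels.HexVertex), u ∈ Λ → v ∈ Λ → u ≠ v → (∑ᶠ E ∈ {E : Finset (Sym2 Literature.Probability.LatticeModels.HexVertex) | (∀ e ∈ E, e ∈ (Literature.Probability.LatticeModels.hexGraph).edgeSet ∧ ∀ w ∈ e, w ∈ (↑Λ : Set Literature.Probability.LatticeModels.HexVertex)) ∧ ∀ w : Literature.Probability.LatticeModels.HexVertex, (Odd (E.filter (fun e => w ∈ e)).card ↔ (w = u ∨ w = v))}, y ^ E.card) ≤ Real.exp (-(cδ * dist (Literature.Probability.LatticeModels.hexCenter u) (Literature.Probability.LatticeModels.hexCenter v))) * Summit.CriticalPhenomena.SAWScalingLimit.Theorems.SAWMassiveIsingTilt.Zloop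 Literature.Probability.LatticeModels.hexGraph (↑Λ : Set Literature.Probability.LatticeModels.HexVertex) y) → ((H.edgeSet.ncard : ℝ) ≤ NE) → NE * (18 * (C₀ * (ε / (4 * δ) + 1) ^ 2) ^ 2 * Real.exp (-(cδ * (ε / (8 * δ))))) ≤ Real.log (1 + θ) → ∀ (S₁ S₂ : Set Literature.Probability.LatticeModels.HexVertex), (∀ v : Literature.Probability.LatticeModels.HexVertex, v ∉ S₁ → v ∈ V') → (∀ v : Literature.Probability.LatticeModels.HexVertex, v ∉ S₂ → v ∈ V') → (∀ v : Literature.Probability.LatticeModels.HexVertex, v ∉ S₁ → ∀ k ∈ K, ε < dist ((δ : ℂ) * Literature.Probability.LatticeModels.hexCenter v) k) → (∀ v : Literature.Probability.LatticeModels.HexVertex, v ∉ S₂ → ∀ k ∈ K, ε < dist ((δ : ℂ) * Literature.Probability.LatticeModels.hexCenter v) k) → Summit.CriticalPhenomena.SAWScalingLimit.Theorems.SAWMassiveIsingTilt.Zloop H S₁ y * Summit.CriticalPhenomena.SAWScalingLimit.Theorems.SAWMassiveIsingTilt.Zloop H' S₂ y ≤ (1 + θ) * (Summit.CriticalPhenomena.SAWScalingLimit.Theorems.SAWMassiveIsingTilt.Zloop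 H' S₁ y * Summit.CriticalPhenomena.SAWScalingLimit.Theorems.SAWMassiveIsingTilt.Zloop H S₂ y) :=
  -- LANDED (p157736): Theorems/SAWMassiveIsingTiltMassiveWindowSLE…, same name + signature
  Summit.CriticalPhenomena.SAWScalingLimit.Theorems.MassiveWindowSLE.Birth.stub_zloopRatioMixingCore


/-- **Stub F3 `stub_zloopRateRatioMixing` (M'', the engine along fast RATE-schedules, provable now from
F2 + Mgeo): for a fast schedule `m` with rate `c` (`c(δ)/(δ log δ⁻¹) → ∞` and the uniform
finite-volume two-point bound at the window weight), a hull pair, `ε, θ > 0` and small `δ`, uniformly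
in the endpoints and in two `Ω'_δ`-SAWs `ε`-away from `cl (D ∖ D')`:
`Z(γ₁ᶜ) Z'(γ₂ᶜ) ≤ (1 + θ) Z'(γ₁ᶜ) Z(γ₂ᶜ)`. Proof: Mgeo supplies `C₀`, `H' ≤ H` and the discrepancy
clause eventually; `#E(Ω_δ) ≤ (C₀(R/δ+1)²)²`; `c(δ) ≥ (80/ε) δ log δ⁻¹` eventually makes
`e^{-cε/(8δ)} ≤ δ^{10}` and the F2 threshold `≤ log(1+θ)`; apply F2 with `K = cl (D ∖ D')`,
`V' = Ω'_δ`, `S_j = γ_jᶜ` (`wn_support_far_of_curve_mem`). -/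
theorem stub_zloopRateRatioMixing :
    ∀ (m c : ℝ → ℝ), Filter.Tendsto (fun δ => m δ * δ) (nhdsWithin 0 (Set.Ioi 0)) (nhds 0) ∧ Filter.Tendsto (fun δ => m δ / Real.log δ⁻¹) (nhdsWithin 0 (Set.Ioi 0)) Filter.atTop → (Filter.Tendsto (fun δ => c δ / (δ * Real.log δ⁻¹)) (nhdsWithin 0 (Set.Ioi 0)) Filter.atTop ∧ ∀ᶠ δ in nhdsWithin 0 (Set.Ioi 0), ∀ (Λ : Finset Literature.Probability.LatticeModels.HexVertex) (u v : Literature.Probability.LatticeModels.HexVertex), u ∈ Λ → v ∈ Λ → u ≠ v → (∑ᶠ E ∈ {E : Finset (Sym2 Literature.Probability.LatticeModels.HexVertex) | (∀ e ∈ E, e ∈ (Literature.Probability.LatticeModels.hexGraph).edgeSet ∧ ∀ w ∈ e, w ∈ (↑Λ : Set Literature.Probability.LatticeModels.HexVertex)) ∧ ∀ w : Literature.Probability.LatticeModels.HexVertex, (Odd (E.filter (fun e => w ∈ e)).card ↔ (w = u ∨ w = v))}, ((Real.sqrt 3)⁻¹ - m δ * δ) ^ E.card) ≤ Real.exp (-(c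 δ * dist (Literature.Probability.LatticeModels.hexCenter u) (Literature.Probability.LatticeModels.hexCenter v))) * Summit.CriticalPhenomena.SAWScalingLimit.Theorems.SAWMassiveIsingTilt.Zloop Literature.Probability.LatticeModels.hexGraph (↑Λ : Set Literature.Probability.LatticeModels.HexVertex) ((Real.sqrt 3)⁻¹ - m δ * δ)) → ∀ (D D' : Literature.Probability.RandomPlanarGeometry.DobrushinDomain), D.IsHullSubdomain D' → ∀ ε : ℝ, 0 < ε → ∀ θ : ℝ, 0 < θ → ∀ᶠ δ in nhdsWithin 0 (Set.Ioi 0), ∀ (a b : Literature.Probability.LatticeModels.HexVertex) (γ₁ γ₂ : Literature.Probability.RandomPlanarGeometry.SAW.HexDomainSAW D'.carrier δ a b), γ₁.curve ∈ {γ : Literature.Probability.RandomPlanarGeometry.CurveClass ℂ | ∀ z ∈ γ.range, ∀ k ∈ closure (D.carrier \ D'.carrier), ε < dist z k} → γ₂.curve ∈ {γ : Literature.Probability.RandomPlanarGeometry.CurveClass ℂ | ∀ z ∈ γ.range, ∀ k ∈ closure (D.carrier \ D'.carrier), ε < dist z k} → Summit.CriticalPhenomena.SAWScalingLimit.Theorems.SAWMassiveIsingTilt.Zloop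 (Literature.Probability.RandomPlanarGeometry.SAW.hexDomainGraph D.carrier δ) {v | v ∉ γ₁.walk.support} ((Real.sqrt 3)⁻¹ - m δ * δ) * Summit.CriticalPhenomena.SAWScalingLimit.Theorems.SAWMassiveIsingTilt.Zloop (Literature.Probability.RandomPlanarGeometry.SAW.hexDomainGraph D'.carrier δ) {v | v ∉ γ₂.walk.support} ((Real.sqrt 3)⁻¹ - m δ * δ) ≤ (1 + θ) * (Summit.CriticalPhenomena.SAWScalingLimit.Theorems.SAWMassiveIsingTilt.Zloop (Literature.Probability.RandomPlanarGeometry.SAW.hexDomainGraph D'.carrier δ) {v | v ∉ γ₁.walk.support} ((Real.sqrt 3)⁻¹ - m δ * δ) * Summit.CriticalPhenomena.SAWScalingLimit.Theorems.SAWMassiveIsingTilt.Zloop (Literature.Probability.RandomPlanarGeometry.SAW.hexDomainGraph D.carrier δ) {v | v ∉ γ₂.walk.support} ((Real.sqrt 3)⁻¹ - m δ * δ)) :=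
  -- LANDED (p158223): Theorems/SAWMassiveIsingTiltMassiveWindowSLE…, same name + signature
  Summit.CriticalPhenomena.SAWScalingLimit.Theorems.MassiveWindowSLE.Birth.stub_zloopRateRatioMixing


/-- **R' (reduction): nesting + RATE-form ratio mixing ⇒ the restriction defect** — LANDED (p163174,
`Theorems/SAWMassiveIsingTiltMassiveWindowSLELineReduction.lean`) under the same name; used through
`massiveWindowSLE_of_covariantSimpleRateWindowLimit` below. -/
example := @Summit.CriticalPhenomena.SAWScalingLimit.Theorems.MassiveWindowSLE.Birth.windowRestrictionDefect_of_rateMixing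

/-- **Stub 2b' (passage glue, r10, provable now — replaces 2b + 3a + 3b): restriction defect ⇒
AVOIDANCE-form restriction.** Given a window-limit family `P` that is chordal and carried by simple
curves, and the two-sided restriction defect with an `ε`-layer produced by the engine (R') for this
schedule and tilt, `P` satisfies two-sided restriction over hull subdomains in avoidance form:
`P D' (T) · P D {γ ∩ cl (D ∖ D') = ∅} = P D (T ∩ {γ ∩ cl (D ∖ D') = ∅})`. Same portmanteau glue as the
landed 2b (`hrd_measure_inter_mul_le_of_tendstoLaw`), but the `ε`-layer is removed on the `P D`-side by
monotone convergence `O_{1/(k+1)} ↑ {avoid}` instead of NoTouch, and on the `P D'`-side by simple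
carriage (`P D' {avoid} = 1`); common endpoint approximations from the landed stub C. NO boundary
estimate enters: the near-touch stub 3a of r5–r9 is gone from the line. -/
theorem stub_avoidRestrictionOfDefect :
    ∀ (m x : ℝ → ℝ) (P : Literature.Probability.RandomPlanarGeometry.ChordalFamily), (∀ (D : Literature.Probability.RandomPlanarGeometry.DobrushinDomain) (a b : ℝ → Literature.Probability.LatticeModels.HexVertex), Literature.Probability.RandomPlanarGeometry.SAW.IsEmbEndpointApprox Literature.Probability.LatticeModels.hexGraph Literature.Probability.LatticeModels.hexCenter D a b → Literature.Probability.RandomPlanarGeometry.TendstoLaw (fun δ (γ : Literature.Probability.RandomPlanarGeometry.SAW.HexDomainSAW D.carrier δ (a δ) (b δ)) => γ.curve) (fun δ => Summit.CriticalPhenomena.SAWScalingLimit.Theorems.SAWMassiveIsingTilt.tiltLaw D.carrier δ (x δ) ((Real.sqrt 3)⁻¹ - m δ * δ) (a δ) (b δ)) id (P D)) → P.IsChordal → P.IsCarriedBySimpleCurves → (∀ (D D' : Literature.Probability.RandomPlanarGeometry.DobrushinDomain), D.IsHullSubdomain D' → ∀ (a b : ℝ → Literature.Probability.LatticeModels.HexVertex),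 Literature.Probability.RandomPlanarGeometry.SAW.IsEmbEndpointApprox Literature.Probability.LatticeModels.hexGraph Literature.Probability.LatticeModels.hexCenter D a b → Literature.Probability.RandomPlanarGeometry.SAW.IsEmbEndpointApprox Literature.Probability.LatticeModels.hexGraph Literature.Probability.LatticeModels.hexCenter D' a b → ∀ ε : ℝ, 0 < ε → ∀ θ : ℝ, 0 < θ → ∀ᶠ δ in nhdsWithin 0 (Set.Ioi 0), ∃ q : NNReal, ∀ B : Set (Literature.Probability.RandomPlanarGeometry.CurveClass ℂ), MeasurableSet B → (MeasureTheory.Measure.map (fun γ : Literature.Probability.RandomPlanarGeometry.SAW.HexDomainSAW D.carrier δ (a δ) (b δ) => γ.curve) (Summit.CriticalPhenomena.SAWScalingLimit.Theorems.SAWMassiveIsingTilt.tiltLaw D.carrier δ (x δ) ((Real.sqrt 3)⁻¹ - m δ * δ) (a δ) (b δ))) (B ∩ {γ : Literature.Probability.RandomPlanarGeometry.CurveClass ℂ | ∀ z ∈ γ.range, ∀ k ∈ closure (D.carrier \ D'.carrier), ε < dist z k}) ≤ ENNReal.ofReal (1 + θ) * (q : ENNReal) * (MeasureTheory.Measure.map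 (fun γ : Literature.Probability.RandomPlanarGeometry.SAW.HexDomainSAW D'.carrier δ (a δ) (b δ) => γ.curve) (Summit.CriticalPhenomena.SAWScalingLimit.Theorems.SAWMassiveIsingTilt.tiltLaw D'.carrier δ (x δ) ((Real.sqrt 3)⁻¹ - m δ * δ) (a δ) (b δ))) (B ∩ {γ : Literature.Probability.RandomPlanarGeometry.CurveClass ℂ | ∀ z ∈ γ.range, ∀ k ∈ closure (D.carrier \ D'.carrier), ε < dist z k}) ∧ (q : ENNReal) * (MeasureTheory.Measure.map (fun γ : Literature.Probability.RandomPlanarGeometry.SAW.HexDomainSAW D'.carrier δ (a δ) (b δ) => γ.curve) (Summit.CriticalPhenomena.SAWScalingLimit.Theorems.SAWMassiveIsingTilt.tiltLaw D'.carrier δ (x δ) ((Real.sqrt 3)⁻¹ - m δ * δ) (a δ) (b δ))) (B ∩ {γ : Literature.Probability.RandomPlanarGeometry.CurveClass ℂ | ∀ z ∈ γ.range, ∀ k ∈ closure (D.carrier \ D'.carrier), ε < dist z k}) ≤ ENNReal.ofReal (1 + θ) * (MeasureTheory.Measure.map (fun γ : Literature.Probability.RandomPlanarGeometry.SAW.HexDomainSAW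 D.carrier δ (a δ) (b δ) => γ.curve) (Summit.CriticalPhenomena.SAWScalingLimit.Theorems.SAWMassiveIsingTilt.tiltLaw D.carrier δ (x δ) ((Real.sqrt 3)⁻¹ - m δ * δ) (a δ) (b δ))) (B ∩ {γ : Literature.Probability.RandomPlanarGeometry.CurveClass ℂ | ∀ z ∈ γ.range, ∀ k ∈ closure (D.carrier \ D'.carrier), ε < dist z k})) → ∀ (D D' : Literature.Probability.RandomPlanarGeometry.DobrushinDomain), D.IsHullSubdomain D' → ∀ T : Set (Literature.Probability.RandomPlanarGeometry.CurveClass ℂ), MeasurableSet T → P D' T * P D {γ | Disjoint γ.range (closure (D.carrier \ D'.carrier))} = P D (T ∩ {γ | Disjoint γ.range (closure (D.carrier \ D'.carrier))}) :=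
  -- LANDED (p161236): Theorems/SAWMassiveIsingTiltMassiveWindowSLE…, same name + signature
  Summit.CriticalPhenomena.SAWScalingLimit.Theorems.MassiveWindowSLE.Birth.stub_avoidRestrictionOfDefect

/-- **Stub T' (identification glue, r10, provable now): avoidance-form restriction ⇒ hull
restriction.** A chordal, conformally covariant family carried by simple curves with two-sided
restriction over hull subdomains in AVOIDANCE form has it in the tree's CLOSED form
`ChordalFamily.IsHullRestriction` (`{γ ⊆ cl D'}`). Reason: the tree's proof of [LSW03] p. 5 result 2
(uniqueness) consumes hull restriction only through avoidance probabilities of pulled-back hulls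
(`RestrictionPullback.pullbackLaw_avoid_hullProduct`), so the avoidance form already identifies `P` with
the chordal SLE_{8/3} family (`exists_isSLECurve_eightThirds`, `ChordalFamily.spec_of_isSLELaw_eightThirds`),
which has closed-form hull restriction (`IsSLELaw.hullRestriction_eightThirds_holds`, [LSW03] Thm. 6.1).
In particular the touching event `{γ ⊆ cl D', γ ∩ cl (D ∖ D') ≠ ∅}` (NoTouch) is null for free. -/
theorem stub_hullRestrictionOfAvoidRestriction :
    ∀ P : Literature.Probability.RandomPlanarGeometry.ChordalFamily, P.IsChordal → P.IsConformallyCovariant → (∀ (D D' : Literature.Probability.RandomPlanarGeometry.DobrushinDomain), D.IsHullSubdomain D' → ∀ T : Set (Literature.Probability.RandomPlanarGeometry.CurveClass ℂ), MeasurableSet T → P D' T * P D {γ | Disjoint γ.range (closure (D.carrier \ D'.carrier))} = P D (T ∩ {γ | Disjoint γ.range (closure (D.carrier \ D'.carrier))})) → P.IsCarriedBySimpleCurves → P.IsHullRestriction :=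
  -- LANDED (p161180): Theorems/SAWMassiveIsingTiltMassiveWindowSLE…, same name + signature
  Summit.CriticalPhenomena.SAWScalingLimit.Theorems.MassiveWindowSLE.Birth.stub_hullRestrictionOfAvoidRestriction

/-- **Stub T (identification glue, provable now): a window-limit family with the LSW axioms gives
the crux.** If some window schedule (`m → +∞`, `m δ · δ → 0`) and tilt have a window-limit family
`P` (weak limit of the tilted interface laws in every Dobrushin domain along every hexagonal endpoint
approximation) which is chordal, conformally covariant, has two-sided restriction over hull
subdomains and is carried by simple curves, then the crux holds — stated here as `MassiveWindowSLE` read through the named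
`tiltLaw` (`Theorems.SAWMassiveIsingTilt.massiveWindowSLE_iff`, `Iff.rfl`; the skeleton checker wants exactly one theorem
concluding the crux constant itself): Lawler–Schramm–Werner 2003
p. 5 result 2 in hull form — PROVED in the tree (`LawlerSchrammWerner2003_unique_holds`,
`ChordalFamily.spec_of_isSLELaw_eightThirds`, `IsSLELaw.hullRestriction_eightThirds_holds`,
`ae_isSimpleTrace_sleTrace_of_le_four_holds`, `exists_isSLECurve_eightThirds`) — identifies every
`P D` as the chordal SLE_{8/3} law, and `TendstoLaw` moves along `integral_map`. The CONVERSE also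
holds (uniqueness in law of chordal SLE, `IsSLECurve.map_eq_holds`), so the crux is EXACTLY the
existence of such a family: the line's cut loses nothing. -/
theorem stub_massiveWindowSLE_of_windowLSWFamily :
    (∃ (m x : ℝ → ℝ) (P : Literature.Probability.RandomPlanarGeometry.ChordalFamily), Filter.Tendsto m (nhdsWithin 0 (Set.Ioi 0)) Filter.atTop ∧ Filter.Tendsto (fun δ => m δ * δ) (nhdsWithin 0 (Set.Ioi 0)) (nhds 0) ∧ (∀ (D : Literature.Probability.RandomPlanarGeometry.DobrushinDomain) (a b : ℝ → Literature.Probability.LatticeModels.HexVertex), Literature.Probability.RandomPlanarGeometry.SAW.IsEmbEndpointApprox Literature.Probability.LatticeModels.hexGraph Literature.Probability.LatticeModels.hexCenter D a b → Literature.Probability.RandomPlanarGeometry.TendstoLaw (fun δ (γ : Literature.Probability.RandomPlanarGeometry.SAW.HexDomainSAW D.carrier δ (a δ) (b δ)) => γ.curve) (fun δ => Summit.CriticalPhenomena.SAWScalingLimit.Theorems.SAWMassiveIsingTilt.tiltLaw D.carrier δ (x δ) ((Real.sqrt 3)⁻¹ - m δ * δ) (a δ) (b δ)) id (P D)) ∧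 P.IsChordal ∧ P.IsConformallyCovariant ∧ P.IsHullRestriction ∧ P.IsCarriedBySimpleCurves) → ∃ m x : ℝ → ℝ, Filter.Tendsto m (nhdsWithin 0 (Set.Ioi 0)) Filter.atTop ∧ Filter.Tendsto (fun δ => m δ * δ) (nhdsWithin 0 (Set.Ioi 0)) (nhds 0) ∧ ∀ (D : Literature.Probability.RandomPlanarGeometry.DobrushinDomain) (a b : ℝ → Literature.Probability.LatticeModels.HexVertex), Literature.Probability.RandomPlanarGeometry.SAW.IsEmbEndpointApprox Literature.Probability.LatticeModels.hexGraph Literature.Probability.LatticeModels.hexCenter D a b → Literature.Probability.RandomPlanarGeometry.ConvergesInLawToSLE ((8 : NNReal) / 3) D (fun δ (γ : Literature.Probability.RandomPlanarGeometry.SAW.HexDomainSAW D.carrier δ (a δ) (b δ)) => γ.curve) (fun δ => Summit.CriticalPhenomena.SAWScalingLimit.Theorems.SAWMassiveIsingTilt.tiltLaw D.carrier δ (x δ) ((Real.sqrt 3)⁻¹ - m δ * δ) (a δ) (b δ)) :=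
  -- LANDED (p146711): Theorems/SAWMassiveIsingTiltMassiveWindowSLE…, same name + signature
  Summit.CriticalPhenomena.SAWScalingLimit.Theorems.MassiveWindowSLE.Birth.stub_massiveWindowSLE_of_windowLSWFamily

/-- **The skeleton read as a (sorried) proof of the crux** — the form `#h21_check_skeleton` audits
(concludes the crux BY NAME, no hypotheses; `sorry` enters only through the declared `stub_*`): the
landed composition `massiveWindowSLE_of_covariantSimpleRateWindowLimit` (p163174; = r10's
`MassiveWindowSLE_of` with Ch, N, F1–F3, R', 2b', T', T fed by their landed theorems) applied to S1'. -/
theorem MassiveWindowSLE_from_stubs :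
    Summit.CriticalPhenomena.SAWScalingLimit.Theses.SAWMassiveIsingTilt.MassiveWindowSLE :=
  -- composition LANDED (p163174): S1' ⇒ crux, every other stub fed by its landed theorem
  Summit.CriticalPhenomena.SAWScalingLimit.Theorems.MassiveWindowSLE.Birth.massiveWindowSLE_of_covariantSimpleRateWindowLimit
    stub_covariantSimpleRateWindowLimit

end Summit.CriticalPhenomena.SAWScalingLimit.Cruxes.MassiveWindowSLE.Birth
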